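import Mathlib
import HarnessLib
import Summits.HubbardSuperconductivity.HubbardSuperconductivity.Theorems.KLProgrammeKLRegimeSplitSlotsV17F
import Summits.HubbardSuperconductivity.HubbardSuperconductivity.Theorems.KLProgrammeKLRegimeTwoLegReadJetDefs
import Summits.HubbardSuperconductivity.HubbardSuperconductivity.Theorems.KLProgrammeKLRegimeTwoLegCurvatureConsts

/-!
# Route `KLProgramme` — K3 gen 7-flow, engine-flow child `KLRegimeEngineV17F2` (stmt-HubbardSuperconductivity-20437, gen 8; gen-7 id 20368 retired), stub (C)
# `stub_twoLeg_curvature : … → TwoLegReadJetBound L M klC4aJetC (klC4aJetC' P R) β U μ (klFlowFrameU L M β U μ n) n`: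
# the ASSEMBLY LAYER of the C4a lane's proof architecture (plan g16 (c4a-ii), KL STATUS 2026-08-27 l.2683; memo HOME/hubbard-kl-c4a-1/C4A-PLAN.md §9)

Cell `gate-hubbard-kl`, lane hubbard-kl-c4a-1 (prover-designate of stub (C)).  The stub bounds the CUMULATIVE reading `ν_n(K)(θ) = klLocalPart … K n θ` at the
flow frame `K = K_n`.  By the very definition of p2's curve profile (`klTwoLegCurveProfile_succ`),
  `ν_{n+1}(K) = δ_{n+1}(K) + ν_n(K)`     (at ANY fixed frame `K`; `δ` = the scale increment at fixed frame),
so `TwoLegReadJetBound … K (n+1)` follows from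
  (A) `TwoLegCurveJetBound … c c' … K (n+1)` — the SLICE INCREMENT at the fixed (tame) frame: C4a-reg proper, this lane's analytic lemma (co-moving
      chart, …C4aInvariantDefs/…LevelChart/…CoMovingIntegral/…TangentialSoftness), and
  (P) a jet bound `curveJetBar e e' U k (n+1)` on the PREVIOUS-scale reading AT THE NEW FRAME, `θ ↦ ν_n(K_{n+1})(θ)` — the renormalisation residue:
      = (B) the frame response `Σ^{res,K_{n+1}}_{>Λ_n} − Σ^{res,K_n}_{>Λ_n}` (p2's covariance-response door, jet form) + (C) the Jackson remainder
      `ν_n(K_n) − klFlowPiece n` read on the new curve (k3c3's `abs_eval_klFlowPieceJackson_sub_le` family) — supplied by those doors,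
with constants adding entrywise (`curveJetBar_add`).  At scale `0` the frame is `K₀ = 0` and `ν₀(0) = δ₀(0)` (`klTwoLegCurveProfile_zero`,
`TrigPolyC4v.eval_zero`), so (A) alone gives the stub.

* §1 `curveJetBar_add`; §2 `twoLegReadJetBound_zero_of_curveJetBound` (n = 0, K = 0); §3 `twoLegReadJetBound_succ_of_curveJetBound_of_prev` (any K) and
  its flow instance `twoLegReadJetBound_flow_succ` (K := klFlowFrameU … (n+1)); §4 the fit to C4a's tables: if `c k + e k ≤ klC4aJetC k` and
  `c' k + e' k ≤ klC4aJetC' P R k` then the stub's literal conclusion (`twoLegReadJetBound_flow_succ_klC4aJetC`, via the tree's `TwoLegReadJetBound.mono`).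

Bookkeeping only (sums of functions, `iteratedDeriv_add`, triangle inequality); nothing is asserted about the Hubbard model; (A) and (P) are hypotheses.
-/

noncomputable section

namespace Summit.HubbardSuperconductivity.HubbardSuperconductivity.Theorems.C4a

set_option linter.dupNamespace false -- summit = problem name (single-conjunct summit), D-0017

open Real Literature.MathematicalPhysics.QuantumLattice Literature.Probability.LatticeModels
open Summit.HubbardSuperconductivity.HubbardSuperconductivity.Theorems.KLRegimeSplit

/-! ## §1 Bars add -/

/-- `curveJetBar` is additive in its constant tables. -/
theorem curveJetBar_add (c c' e e' : ℕ → ℝ) (U : ℝ) (k n : ℕ) :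
    curveJetBar (fun k => c k + e k) (fun k => c' k + e' k) U k n = curveJetBar c c' U k n + curveJetBar e e' U k n := by
  simp only [curveJetBar]
  ring

/-! ## §2 Scale 0 at the bare frame -/

section Model

variable {L M : ℕ} [NeZero L] [NeZero M]

/-- At `K = 0` the cumulative reading IS the scale-0 profile: `ν₀(0)(θ) = δ₀(0)(θ)`. -/
theorem klLocalPart_zero_frame_eq_profile (β U μ : ℝ) (θ : ℝ) :
    klLocalPart L M β U μ 0 0 θ = klTwoLegCurveProfile L M β U μ 0 0 θ := by
  simp [klTwoLegCurveProfile_zero]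

/-- **Scale 0**: the slice-increment bound at the bare frame gives the stub at `n = 0` with the same tables. -/
theorem twoLegReadJetBound_zero_of_curveJetBound {c c' : ℕ → ℝ} {β U μ : ℝ}
    (hA : TwoLegCurveJetBound L M c c' β U μ 0 0) : TwoLegReadJetBound L M c c' β U μ 0 0 := by
  have hfun : (fun θ : ℝ => klLocalPart L M β U μ 0 0 θ) = klTwoLegCurveProfile L M β U μ 0 0 :=
    funext fun θ => klLocalPart_zero_frame_eq_profile β U μ θ
  refine ⟨?_, fun k hk θ => ?_⟩
  · rw [hfun]; exact hA.1
  · rw [hfun]; exact hA.2 k hk θ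

/-! ## §3 Scale n + 1 at any fixed frame: increment + previous reading at the same frame -/

/-- `ν_{n+1}(K) = δ_{n+1}(K) + ν_n(K)` as functions of the angle. -/
theorem klLocalPart_succ_eq_profile_add (β U μ : ℝ) (K : TrigPolyC4v) (n : ℕ) :
    (fun θ : ℝ => klLocalPart L M β U μ K (n + 1) θ) =
      klTwoLegCurveProfile L M β U μ K (n + 1) + fun θ : ℝ => klLocalPart L M β U μ K n θ := by
  funext θ
  simp [klTwoLegCurveProfile_succ]

/-- **Scale `n+1`, any fixed frame `K`**: (A) the slice-increment jets `TwoLegCurveJetBound … c c' … K (n+1)` and (P) jets of the previous-scale reading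
at the SAME frame, `θ ↦ ν_n(K)(θ)`, within `curveJetBar e e' U k (n+1)`, give the cumulative-reading jets with the tables added. -/
theorem twoLegReadJetBound_succ_of_curveJetBound_of_prev {c c' e e' : ℕ → ℝ} {β U μ : ℝ} {K : TrigPolyC4v} {n : ℕ}
    (hA : TwoLegCurveJetBound L M c c' β U μ K (n + 1))
    (hPdiff : ContDiff ℝ 4 (fun θ : ℝ => klLocalPart L M β U μ K n θ))
    (hP : ∀ k ≤ 4, ∀ θ : ℝ, |iteratedDeriv k (fun θ : ℝ => klLocalPart L M β U μ K n θ) θ| ≤ curveJetBar e e' U k (n + 1)) :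
    TwoLegReadJetBound L M (fun k => c k + e k) (fun k => c' k + e' k) β U μ K (n + 1) := by
  have hsum := klLocalPart_succ_eq_profile_add (L := L) (M := M) β U μ K n
  refine ⟨?_, fun k hk θ => ?_⟩
  · rw [hsum]; exact hA.1.add hPdiff
  · rw [hsum, curveJetBar_add]
    have hk' : (k : WithTop ℕ∞) ≤ 4 := by exact_mod_cast hk
    rw [iteratedDeriv_add (hA.1.contDiffAt.of_le hk') (hPdiff.contDiffAt.of_le hk')]
    exact (abs_add_le _ _).trans (add_le_add (hA.2 k hk θ) (hP k hk θ))

/-- **The flow instance**: at the flow frame `K_{n+1} = klFlowFrameU L M β U μ (n+1)`, (A) + (P) give `TwoLegReadJetBound … K_{n+1} (n+1)` with added tables —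
(P) is the renormalisation residue (frame response (B) + Jackson remainder (C)) of the doors. -/
theorem twoLegReadJetBound_flow_succ {c c' e e' : ℕ → ℝ} {β U μ : ℝ} {n : ℕ}
    (hA : TwoLegCurveJetBound L M c c' β U μ (klFlowFrameU L M β U μ (n + 1)) (n + 1))
    (hPdiff : ContDiff ℝ 4 (fun θ : ℝ => klLocalPart L M β U μ (klFlowFrameU L M β U μ (n + 1)) n θ))
    (hP : ∀ k ≤ 4, ∀ θ : ℝ,
      |iteratedDeriv k (fun θ : ℝ => klLocalPart L M β U μ (klFlowFrameU L M β U μ (n + 1)) n θ) θ| ≤ curveJetBar e e' U k (n + 1)) :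
    TwoLegReadJetBound L M (fun k => c k + e k) (fun k => c' k + e' k) β U μ (klFlowFrameU L M β U μ (n + 1)) (n + 1) :=
  twoLegReadJetBound_succ_of_curveJetBound_of_prev hA hPdiff hP

/-! ## §4 The fit to C4a's tables (the stub's literal conclusion) -/

/-- **Stub (C) at scale `n+1` from (A) + (P) with a split of C4a's tables**: if `c + e ≤ klC4aJetC` and `c' + e' ≤ klC4aJetC' P R` entrywise then
`TwoLegReadJetBound L M klC4aJetC (klC4aJetC' P R) β U μ K_{n+1} (n+1)`. -/
theorem twoLegReadJetBound_flow_succ_klC4aJetC {P : SplitConsts} {R : RenConsts} {c c' e e' : ℕ → ℝ} {β U μ : ℝ} {n : ℕ}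
    (hA : TwoLegCurveJetBound L M c c' β U μ (klFlowFrameU L M β U μ (n + 1)) (n + 1))
    (hPdiff : ContDiff ℝ 4 (fun θ : ℝ => klLocalPart L M β U μ (klFlowFrameU L M β U μ (n + 1)) n θ))
    (hP : ∀ k ≤ 4, ∀ θ : ℝ,
      |iteratedDeriv k (fun θ : ℝ => klLocalPart L M β U μ (klFlowFrameU L M β U μ (n + 1)) n θ) θ| ≤ curveJetBar e e' U k (n + 1))
    (hfit : ∀ k, c k + e k ≤ klC4aJetC k) (hfit' : ∀ k, c' k + e' k ≤ klC4aJetC' P R k) :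
    TwoLegReadJetBound L M klC4aJetC (klC4aJetC' P R) β U μ (klFlowFrameU L M β U μ (n + 1)) (n + 1) :=
  TwoLegReadJetBound.mono hfit hfit' (twoLegReadJetBound_flow_succ hA hPdiff hP)

/-- **Stub (C) at scale `0`** from (A) at the bare frame with tables inside C4a's. -/
theorem twoLegReadJetBound_flow_zero_klC4aJetC {P : SplitConsts} {R : RenConsts} {c c' : ℕ → ℝ} {β U μ : ℝ}
    (hA : TwoLegCurveJetBound L M c c' β U μ 0 0) (hfit : ∀ k, c k ≤ klC4aJetC k) (hfit' : ∀ k, c' k ≤ klC4aJetC' P R k) :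
    TwoLegReadJetBound L M klC4aJetC (klC4aJetC' P R) β U μ (klFlowFrameU L M β U μ 0) 0 := by
  rw [klFlowFrameU_zero]
  exact TwoLegReadJetBound.mono hfit hfit' (twoLegReadJetBound_zero_of_curveJetBound hA)

end Model

end Summit.HubbardSuperconductivity.HubbardSuperconductivity.Theorems.C4a
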